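import Summits.AtomisticToContinuum.FouriersLaw.Theses.EmbeddedDrudeMourre
import Literature.MathematicalPhysics.KineticTheory.HarmonicChaosDecomposition
import HarnessLib

/-!
# The force window, part III: transport of the pair sector to the real cell
(stub `stub_forceWindow` (KT) of line `gram-pencil-harmonic-chaos`, crux `EmbeddedDrudeMourre.DrudeDissolution`,
item stmt-AtomisticToContinuum-12593; `--supports` file, closes nothing)

WHAT. The pair sector `(2,2)` of the zero-wavenumber chaos space lives on the shell
`Shell 2 2 = {c₀ + c₁ = a₀ + a₁} ⊂ 𝕋² × 𝕋²` with its Haar probability measure `σ₂₂`; the threshold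
theorems of the sibling crux stmt-AtomisticToContinuum-12594 live on the real cell `(−π,π]³ ∋ p = (k₁,(k₃,k₂))`
with Lebesgue measure. This file is the dictionary: for every measurable weight `g` on the shell,

  `(Ω₂₂)_*(g σ₂₂) = (2π)⁻³ · (Ω)_*((g ∘ e ∘ ℓ) dp)`      (`forceWindow_pairTransport`, registered helper)

where `e : 𝕋3 → Shell 2 2`, `e(k₁,k₂,k₃) = ((k₁,k₂),(k₃,k₁+k₂−k₃))` is the measure-preserving parametrisation
of the shell (`forceWindow_exists_pairShell`), `ℓ(p) = (↑k₁, ↑k₂, ↑k₃)` lifts real representatives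
(`p = (k₁,(k₃,k₂))`), `Ω₂₂ = sectorPhase ω₂` is the free frequency of the sector and
`Ω(p) = resonanceFn ω₂ k₁ k₂ k₃` the pair resonance function of `LinearisedPhononCollisionOperator.lean`.

HOW. `e` is a continuous additive equivalence of compact groups, hence carries Haar probability to Haar
probability (`HarmonicChaos.measurePreserving_addEquiv`; the Haar instance of `μ𝕋3 = μ𝕋 ⊗ μ𝕋 ⊗ μ𝕋` is
assembled by hand); `ℓ` is measure preserving from the cell to `(2π)³ · μ𝕋3`
(`AddCircle.measurePreserving_mk` coordinatewise, a coordinate swap, `volume = 2π · μ𝕋` on the circle);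
densities move through push-forwards by `(Φ_*μ).withDensity g = Φ_*(μ.withDensity (g ∘ Φ))`
(`forceWindow_withDensity_map`), and `sectorPhase ω₂ ∘ e = resonanceFn` (`dispersion_coe`). Measure
plumbing over Mathlib; no cited facts.
-/

noncomputable section

namespace Summit.AtomisticToContinuum.FouriersLaw.Theorems.DrudeDissolution.GramPencilHarmonicChaos

open MeasureTheory Filter Set Function Topology
open scoped InnerProductSpace ENNReal ComplexConjugate
open Literature.MathematicalPhysics.KineticTheory
open Literature.MathematicalPhysics.KineticTheory.HeatConduction
open Literature.MathematicalPhysics.KineticTheory.PhononBoltzmann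
open HarmonicChaos ProbabilityTheory
open PinnedChainKinetic (𝕋 𝕋3 μ𝕋 μ𝕋3 k₄ sinT)
open scoped Literature.MathematicalPhysics.KineticTheory.HeatConduction.PinnedChainKinetic

/-! ### Densities through push-forwards -/

/-- `(Φ_*μ).withDensity g = Φ_*(μ.withDensity (g ∘ Φ))` for measurable `Φ`, `g`. [folklore] -/
theorem forceWindow_withDensity_map {α β : Type*} [MeasurableSpace α] [MeasurableSpace β] {μ : Measure α}
    {Φ : α → β} (hΦ : Measurable Φ) {g : β → ℝ≥0∞} (hg : Measurable g) :
    (μ.map Φ).withDensity g = (μ.withDensity (g ∘ Φ)).map Φ := by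
  ext s hs
  rw [withDensity_apply _ hs, setLIntegral_map hs hg hΦ, Measure.map_apply hΦ hs, withDensity_apply _ (hΦ hs)]
  rfl

/-! ### The band on the circle and on the line -/

/-- The band on the circle at a real representative is the band of `LinearisedPhononCollisionOperator.lean`.
[folklore] -/
@[simp] theorem forceWindow_dispersion_coe (ω₂ x : ℝ) :
    PinnedChainKinetic.dispersion ω₂ (x : 𝕋) = dispersion ω₂ x := rfl

/-- The resonance function on `𝕋3` at real representatives `(↑k₁, ↑k₂, ↑k₃)` is the real resonance function
`resonanceFn ω₂ k₁ k₂ k₃`. [folklore] -/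
theorem forceWindow_resonanceFn_coe (ω₂ k₁ k₂ k₃ : ℝ) :
    PinnedChainKinetic.resonanceFn ω₂ ((k₁ : 𝕋), ((k₂ : 𝕋), (k₃ : 𝕋))) = resonanceFn ω₂ k₁ k₂ k₃ := by
  simp only [PinnedChainKinetic.resonanceFn, k₄, ← AddCircle.coe_add, ← AddCircle.coe_sub,
    forceWindow_dispersion_coe]
  rfl

/-! ### Real representatives: the cell covers `(2π)³ · μ𝕋3` -/

/-- The lift `p = (k₁,(k₃,k₂)) ↦ (↑k₁, ↑k₂, ↑k₃)` is measure preserving from the cell `(−π,π]³` (Lebesgue) to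
`𝕋3` with the product of the circle volumes (each of mass `2π`). [folklore] -/
theorem forceWindow_measurePreserving_lift :
    MeasurePreserving (fun p : ℝ × ℝ × ℝ => (((p.1 : ℝ) : 𝕋), (((p.2.2 : ℝ) : 𝕋), ((p.2.1 : ℝ) : 𝕋))))
      ((volume.restrict (Ioc (-Real.pi) Real.pi)).prod ((volume.restrict (Ioc (-Real.pi) Real.pi)).prod
        (volume.restrict (Ioc (-Real.pi) Real.pi))))
      ((volume : Measure 𝕋).prod ((volume : Measure 𝕋).prod (volume : Measure 𝕋))) := by
  have h𝕋 : MeasurePreserving (fun x : ℝ => (x : 𝕋)) (volume.restrict (Ioc (-Real.pi) Real.pi)) volume := by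
    have h := AddCircle.measurePreserving_mk (2 * Real.pi) (-Real.pi)
    rwa [show -Real.pi + 2 * Real.pi = Real.pi by ring] at h
  have hswap : MeasurePreserving (fun p : ℝ × ℝ × ℝ => (p.1, (p.2.2, p.2.1)))
      ((volume.restrict (Ioc (-Real.pi) Real.pi)).prod ((volume.restrict (Ioc (-Real.pi) Real.pi)).prod
        (volume.restrict (Ioc (-Real.pi) Real.pi))))
      ((volume.restrict (Ioc (-Real.pi) Real.pi)).prod ((volume.restrict (Ioc (-Real.pi) Real.pi)).prod
        (volume.restrict (Ioc (-Real.pi) Real.pi)))) :=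
    (MeasurePreserving.id _).prod Measure.measurePreserving_swap
  have key : (fun p : ℝ × ℝ × ℝ => (((p.1 : ℝ) : 𝕋), (((p.2.2 : ℝ) : 𝕋), ((p.2.1 : ℝ) : 𝕋)))) =
      (Prod.map (fun x : ℝ => (x : 𝕋)) (Prod.map (fun x : ℝ => (x : 𝕋)) (fun x : ℝ => (x : 𝕋)))) ∘
        (fun p : ℝ × ℝ × ℝ => (p.1, (p.2.2, p.2.1))) := rfl
  rw [key]
  exact (h𝕋.prod (h𝕋.prod h𝕋)).comp hswap

/-- On `𝕋3` the product of the circle volumes is `(2π)³ · μ𝕋3`. [folklore] -/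
theorem forceWindow_volume_T3 :
    ((volume : Measure 𝕋).prod ((volume : Measure 𝕋).prod (volume : Measure 𝕋))) =
      (ENNReal.ofReal (2 * Real.pi) ^ 3) • (μ𝕋3 : Measure 𝕋3) := by
  rw [show (volume : Measure 𝕋) = ENNReal.ofReal (2 * Real.pi) • (μ𝕋 : Measure 𝕋) from rfl]
  simp only [Measure.prod_smul_left, Measure.prod_smul_right, smul_smul]
  congr 1
  ring

/-- `(2π)³ ≠ 0` in `ℝ≥0∞`. [folklore] -/
theorem forceWindow_twoPi_cube_ne_zero : (ENNReal.ofReal (2 * Real.pi) ^ 3 : ℝ≥0∞) ≠ 0 :=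
  pow_ne_zero _ ((ENNReal.ofReal_pos.2 Real.two_pi_pos).ne')

/-- `(2π)³ ≠ ∞` in `ℝ≥0∞`. [folklore] -/
theorem forceWindow_twoPi_cube_ne_top : (ENNReal.ofReal (2 * Real.pi) ^ 3 : ℝ≥0∞) ≠ ⊤ :=
  ENNReal.pow_ne_top ENNReal.ofReal_ne_top

/-- **`μ𝕋3` from the cell**: `μ𝕋3 = (2π)⁻³ · ℓ_*(Lebesgue on (−π,π]³)`. [folklore] -/
theorem forceWindow_muT3_eq :
    (μ𝕋3 : Measure 𝕋3) = (ENNReal.ofReal (2 * Real.pi) ^ 3)⁻¹ •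
      Measure.map (fun p : ℝ × ℝ × ℝ => (((p.1 : ℝ) : 𝕋), (((p.2.2 : ℝ) : 𝕋), ((p.2.1 : ℝ) : 𝕋))))
        ((volume.restrict (Ioc (-Real.pi) Real.pi)).prod ((volume.restrict (Ioc (-Real.pi) Real.pi)).prod
          (volume.restrict (Ioc (-Real.pi) Real.pi)))) := by
  rw [forceWindow_measurePreserving_lift.map_eq, forceWindow_volume_T3, smul_smul,
    ENNReal.inv_mul_cancel forceWindow_twoPi_cube_ne_zero forceWindow_twoPi_cube_ne_top, one_smul]

/-- **Push-forwards of weighted `μ𝕋3` from the cell.** For a measurable weight `g` on `𝕋3` and a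
measurable `Ω' : 𝕋3 → ℝ`: `Ω'_*(g μ𝕋3) = (2π)⁻³ · (Ω' ∘ ℓ)_*((g ∘ ℓ) dp)` on the cell. [folklore] -/
theorem forceWindow_map_withDensity_muT3 {g : 𝕋3 → ℝ≥0∞} (hg : Measurable g) {Ω' : 𝕋3 → ℝ}
    (hΩ' : Measurable Ω') :
    Measure.map Ω' ((μ𝕋3 : Measure 𝕋3).withDensity g) = (ENNReal.ofReal (2 * Real.pi) ^ 3)⁻¹ •
      Measure.map (fun p : ℝ × ℝ × ℝ => Ω' (((p.1 : ℝ) : 𝕋), (((p.2.2 : ℝ) : 𝕋), ((p.2.1 : ℝ) : 𝕋))))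
        (((volume.restrict (Ioc (-Real.pi) Real.pi)).prod ((volume.restrict (Ioc (-Real.pi) Real.pi)).prod
          (volume.restrict (Ioc (-Real.pi) Real.pi)))).withDensity
            (fun p : ℝ × ℝ × ℝ => g (((p.1 : ℝ) : 𝕋), (((p.2.2 : ℝ) : 𝕋), ((p.2.1 : ℝ) : 𝕋))))) := by
  have hl : Measurable (fun p : ℝ × ℝ × ℝ => (((p.1 : ℝ) : 𝕋), (((p.2.2 : ℝ) : 𝕋), ((p.2.1 : ℝ) : 𝕋)))) :=
    forceWindow_measurePreserving_lift.measurable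
  rw [forceWindow_muT3_eq, withDensity_smul_measure, Measure.map_smul, forceWindow_withDensity_map hl hg,
    Measure.map_map hΩ' hl]
  rfl

/-! ### The pair shell is a `3`-torus -/

/-- The shells are Borel spaces (stated for variable `m, n`: for numerals typeclass search times out).
[folklore] -/
theorem forceWindow_borelSpace_shell (m n : ℕ) : BorelSpace (Shell m n) := inferInstance

/-- `μ𝕋3` is a Haar measure (instance assembled by hand: typeclass search does not find it). [folklore] -/
theorem forceWindow_isAddHaarMeasure_muT3 : (μ𝕋3 : Measure 𝕋3).IsAddHaarMeasure := by
  haveI h1 : (μ𝕋.prod μ𝕋).IsAddHaarMeasure := inferInstance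
  haveI h2 : SFinite (μ𝕋.prod μ𝕋) := inferInstance
  haveI h3 : MeasurableAdd (𝕋 × 𝕋) := inferInstance
  exact Measure.prod.instIsAddHaarMeasure μ𝕋 (μ𝕋.prod μ𝕋)

/-- **The pair shell is a `3`-torus**: `(k₁,k₂,k₃) ↦ ((k₁,k₂),(k₃,k₁+k₂−k₃))` is a measure-preserving map
`(𝕋3, μ𝕋3) → (Shell 2 2, σ₂₂)` (a continuous additive isomorphism of compact groups). [folklore] -/
theorem forceWindow_exists_pairShell :
    ∃ e : 𝕋3 → Shell 2 2, MeasurePreserving e μ𝕋3 (shellMeasure 2 2) ∧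
      ∀ κ : 𝕋3, ((e κ : Shell 2 2) : SectorConfig 2 2).1 = ![κ.1, κ.2.1] ∧
        ((e κ : Shell 2 2) : SectorConfig 2 2).2 = ![κ.2.2, κ.1 + κ.2.1 - κ.2.2] := by
  have hmem : ∀ κ : 𝕋3, ((![κ.1, κ.2.1], ![κ.2.2, κ.1 + κ.2.1 - κ.2.2]) : SectorConfig 2 2) ∈ shell 2 2 := by
    intro κ
    rw [mem_shell_iff]
    simp [Fin.sum_univ_two]
  let E : 𝕋3 ≃+ Shell 2 2 :=
    { toFun := fun κ => ⟨(![κ.1, κ.2.1], ![κ.2.2, κ.1 + κ.2.1 - κ.2.2]), hmem κ⟩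
      invFun := fun s => ((s : SectorConfig 2 2).1 0, (s : SectorConfig 2 2).1 1, (s : SectorConfig 2 2).2 0)
      left_inv := fun κ => by simp
      right_inv := by
        intro s
        have hs := (mem_shell_iff (s : SectorConfig 2 2)).1 s.2
        simp only [Fin.sum_univ_two] at hs
        apply Subtype.ext
        ext i
        · fin_cases i
          · rfl
          · rfl
        · fin_cases i
          · rfl
          · show (s : SectorConfig 2 2).1 0 + (s : SectorConfig 2 2).1 1 - (s : SectorConfig 2 2).2 0 =
              (s : SectorConfig 2 2).2 1
            rw [sub_eq_zero] at hs
            rw [hs]; abel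
      map_add' := by
        intro κ κ'
        apply Subtype.ext
        ext i
        · fin_cases i
          · rfl
          · rfl
        · fin_cases i
          · rfl
          · show (κ.1 + κ'.1) + (κ.2.1 + κ'.2.1) - (κ.2.2 + κ'.2.2) =
              (κ.1 + κ.2.1 - κ.2.2) + (κ'.1 + κ'.2.1 - κ'.2.2)
            abel }
  have hc : Continuous E := by
    refine Continuous.subtype_mk (Continuous.prodMk ?_ ?_) _
    · refine continuous_pi fun i => ?_
      fin_cases i
      · exact continuous_fst
      · exact continuous_fst.comp continuous_snd
    · refine continuous_pi fun i => ?_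
      fin_cases i
      · exact continuous_snd.comp continuous_snd
      · exact (continuous_fst.add (continuous_fst.comp continuous_snd)).sub (continuous_snd.comp continuous_snd)
  have hcs : Continuous E.symm := by
    refine Continuous.prodMk ?_ (Continuous.prodMk ?_ ?_)
    · exact (continuous_apply (0 : Fin 2)).comp (continuous_fst.comp continuous_subtype_val)
    · exact (continuous_apply (1 : Fin 2)).comp (continuous_fst.comp continuous_subtype_val)
    · exact (continuous_apply (0 : Fin 2)).comp (continuous_snd.comp continuous_subtype_val)
  haveI := forceWindow_isAddHaarMeasure_muT3
  haveI := forceWindow_borelSpace_shell 2 2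
  exact ⟨E, measurePreserving_addEquiv μ𝕋3 (shellMeasure 2 2) E hc hcs, fun κ => ⟨rfl, rfl⟩⟩

/-- On the pair shell the free frequency is the pair resonance function:
`Ω₂₂(e(k₁,k₂,k₃)) = ω₁ + ω₂ − ω₃ − ω(k₁+k₂−k₃)`. [folklore] -/
theorem forceWindow_sectorPhase_pairShell (ω₂ : ℝ) {e : 𝕋3 → Shell 2 2}
    (he : ∀ κ : 𝕋3, ((e κ : Shell 2 2) : SectorConfig 2 2).1 = ![κ.1, κ.2.1] ∧
      ((e κ : Shell 2 2) : SectorConfig 2 2).2 = ![κ.2.2, κ.1 + κ.2.1 - κ.2.2]) (κ : 𝕋3) :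
    sectorPhase ω₂ (e κ) = PinnedChainKinetic.resonanceFn ω₂ κ := by
  obtain ⟨h1, h2⟩ := he κ
  simp only [sectorPhase, h1, h2, Fin.sum_univ_two, Matrix.cons_val_zero, Matrix.cons_val_one,
    PinnedChainKinetic.resonanceFn, k₄]
  ring

/-! ### The registered dictionary -/

/-- **Registered helper (stub KT, part III): transport of the pair sector to the real cell.** There is a
parametrisation `e : 𝕋3 → Shell 2 2` of the pair shell with created momenta `(k₁, k₂)` and annihilated
momenta `(k₃, k₁+k₂−k₃)` such that for every measurable weight `g` on the shell the push-forward of `g σ₂₂`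
under the free frequency `sectorPhase ω₂` equals `(2π)⁻³` times the push-forward, under the real pair
resonance function `p ↦ resonanceFn ω₂ k₁ k₂ k₃` (`p = (k₁,(k₃,k₂))`), of Lebesgue measure on the cell
`(−π,π]³` weighted by `g ∘ e ∘ (p ↦ (↑k₁, ↑k₂, ↑k₃))`. [folklore] -/
theorem forceWindow_pairTransport : ∀ ω₂ : ℝ, ∃ e : Literature.MathematicalPhysics.KineticTheory.HeatConduction.PinnedChainKinetic.𝕋3 → Literature.MathematicalPhysics.KineticTheory.HeatConduction.HarmonicChaos.Shell 2 2, (∀ κ : Literature.MathematicalPhysics.KineticTheory.HeatConduction.PinnedChainKinetic.𝕋3, ((e κ : Literature.MathematicalPhysics.KineticTheory.HeatConduction.HarmonicChaos.Shell 2 2) : Literature.MathematicalPhysics.KineticTheory.HeatConduction.HarmonicChaos.SectorConfig 2 2).1 = ![κ.1, κ.2.1] ∧ ((e κ : Literature.MathematicalPhysics.KineticTheory.HeatConduction.HarmonicChaos.Shell 2 2) : Literature.MathematicalPhysics.KineticTheory.HeatConduction.HarmonicChaos.SectorConfig 2 2).2 = ![κ.2.2, κ.1 + κ.2.1 - κ.2.2])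 ∧ ∀ g : Literature.MathematicalPhysics.KineticTheory.HeatConduction.HarmonicChaos.Shell 2 2 → ENNReal, Measurable g → MeasureTheory.Measure.map (Literature.MathematicalPhysics.KineticTheory.HeatConduction.HarmonicChaos.sectorPhase ω₂) ((Literature.MathematicalPhysics.KineticTheory.HeatConduction.HarmonicChaos.shellMeasure 2 2).withDensity g) = (ENNReal.ofReal (2 * Real.pi) ^ 3)⁻¹ • MeasureTheory.Measure.map (fun p : ℝ × ℝ × ℝ => Literature.MathematicalPhysics.KineticTheory.PhononBoltzmann.resonanceFn ω₂ p.1 p.2.2 p.2.1) (((MeasureTheory.volume.restrict (Set.Ioc (-Real.pi) Real.pi)).prod ((MeasureTheory.volume.restrict (Set.Ioc (-Real.pi) Real.pi)).prod (MeasureTheory.volume.restrict (Set.Ioc (-Real.pi) Real.pi)))).withDensity (fun p : ℝ × ℝ × ℝ => g (e ((((p.1 : ℝ) : Literature.MathematicalPhysics.KineticTheory.HeatConduction.PinnedChainKinetic.𝕋), (((p.2.2 : ℝ) : Literature.MathematicalPhysics.KineticTheory.HeatConduction.PinnedChainKinetic.𝕋), ((p.2.1 : ℝ) : Literature.MathematicalPhysics.KineticTheory.HeatConduction.PinnedChainKinetic.𝕋)))))))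 := by
  intro ω₂
  obtain ⟨e, he, hcomp⟩ := forceWindow_exists_pairShell
  refine ⟨e, hcomp, fun g hg => ?_⟩
  have hem : Measurable e := he.measurable
  rw [← he.map_eq, forceWindow_withDensity_map hem hg, Measure.map_map (measurable_sectorPhase ω₂ 2 2) hem]
  have hfun : (sectorPhase ω₂ : Shell 2 2 → ℝ) ∘ e = PinnedChainKinetic.resonanceFn ω₂ :=
    funext fun κ => forceWindow_sectorPhase_pairShell ω₂ hcomp κ
  rw [hfun, forceWindow_map_withDensity_muT3 (hg.comp hem) (PinnedChainKinetic.continuous_resonanceFn ω₂).measurable]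
  simp only [Function.comp_apply, forceWindow_resonanceFn_coe]

end Summit.AtomisticToContinuum.FouriersLaw.Theorems.DrudeDissolution.GramPencilHarmonicChaos

end
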